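import Summits.AtomisticToContinuum.HydrodynamicLimit.Theorems.CollisionIsometryCLTAdaptedWeightCLTTLColumnDepolarisationPieces

/-!
# Cloud mass travels through collision chains: the cradle relay — negative knowledge for `stub_pastDamping`
of the line `contact-source-duhamel` of the crux `CollisionIsometryCLT.AdaptedWeightCLT`

Negative-lane support file for the crux `AdaptedWeightCLT` (stmt-AtomisticToContinuum-14868, route
`CollisionIsometryCLT`), line `contact-source-duhamel` (lead `prover-line-stmt-AtomisticToContinuum-14868-0`, landed
vocabulary `Theorems/CollisionIsometryCLTAdaptedWeightCLTLine.lean`), from the standing disprover's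
`Cruxes/AdaptedWeightCLT/Disproof.lean` §5a (cycle 3; refuter-cdisprove-stmt-AtomisticToContinuum-14868-0).

The registered stub `stub_pastDamping` (`CDAlongAt → ∀ t > 0, TailsOn t → PastSmallOn t`, for ALL `0 < σ < 1/2` and all
flow families) is sketched through a weight-gradient term
`Σ_k Σ_i (w_i − w(x_k)) ⟨C, 𝒯(δ_k y_k^{⊗r})_i⟩ ≤ ‖∇φ_N‖_∞ × (displacement of k's cloud)`, the displacement being
"`≤ V Δℓ_N + hops · ε_N` on carriers slower than `V`".  The theorems below (over the landed `mapT, projM, coprojM,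
projV, coprojV, tpow`; tensor-algebra helpers imported from the lead's rev-12 modules `…TimeLocal.Duhamel` and
`…TimeLocal.ColumnDepolarisation`) isolate what that needs and what neither hypothesis of the stub supplies:

* `cradle_relay` — along a chain of `m` steps `(0,1), (1,2), …, (m−1,m)` of the incoherent transport (`pinch` = the
  `some (i,j)` branch of the line's `tStep`, verbatim) with normals parallel to the carried direction `n`, the injected
  piece `n^{⊗r}` moves from carrier `0` to carrier `m` INTACT, at every rank `r ≥ 1` (`cradle_relay_trace`: the full
  trace `‖n‖²` arrives; `cradle_relay_of_ne`: nothing is left behind);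
* `vcradle_relay` — the coherent velocity transfer along the same chain relays `c • n` intact as well.
In the hard-sphere realisation (Newton's cradle: `m + 1` spheres at mutual distance `ε_N` along `n`) the cloud mass is
displaced by `m · ε_N` in arbitrarily short time while no sphere moves more than the gaps.  So the localisation of
INCOHERENT CLOUD MASS is not the free fact "a particle moves at most `|v|Δ` in a window" (true for particles): it is
chain transport, bounded by hop counts × `ε_N` (or by the reach of near-contact clusters met in the window), and the
stub's hypotheses are blind to it — `CDAlongAt` is a MEAN depolarisation over sources (it does not see where the pieces
sit) and `TailsOn` a one-particle VELOCITY tail (it does not see positions or collision counts); the stub carries no H1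
and no smallness of `σ`.  Entropy transfer cannot supply it along the evolved law either: a supersonic chain across
`N^{-4γ}` needs `≍ N^{1/3−4γ}/σ` near-contacts, Gibbs cost `e^{-O(N^{1/3−4γ})}`, sub-exponential in `N`.  The missing
input is a CLOUD-LOCALITY statement (mass-weighted cloud displacement `o(N^{-4γ})` in `L¹(ds dP)` on `[0,t]`), to be
added as a hypothesis / stub or avoided by a re-cut of PAST's bookkeeping; in dense post-implosion transients the chain
("sound") speed diverges near jamming, which is where such a statement is genuinely exposed.  H1 prices only the
PERFECTION of a relay (normals exactly along the chain keep a unit block in the rows of `M`), not the distance covered: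
normals at angle `ψ` pass the fraction `cos²ψ` per hop at rank 2 and still displace it by `ε_N`.
-/

noncomputable section

namespace Summit.AtomisticToContinuum.HydrodynamicLimit.Theorems

namespace AdaptedWeightCLTNegative

open scoped BigOperators InnerProductSpace
open Finset Summit.AtomisticToContinuum.HydrodynamicLimit.Theorems.ContactSourceDuhamel
open Summit.AtomisticToContinuum.HydrodynamicLimit.Theorems.ContactSourceDuhamel.TimeLocal.Duhamel
  (mapT_tpow mapT_coprojM_tpow mapT_projM_tpow)
open Summit.AtomisticToContinuum.HydrodynamicLimit.Theorems.ContactSourceDuhamel.TimeLocal.ColumnDepolarisation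
  (mapT_zero tpow_zero_vec)




variable {r : ℕ}

/-- `P n = n`. [folklore] -/
theorem projV_self {n : V3} (hn : n ≠ 0) : projV n n = n := by
  have h : ‖n‖ ^ 2 ≠ 0 := pow_ne_zero 2 (norm_ne_zero_iff.2 hn)
  simp [projV, h]

/-- `Q n = 0`. [folklore] -/
theorem coprojV_self {n : V3} (hn : n ≠ 0) : coprojV n n = 0 := by
  simp [coprojV, projV_self hn]

/-- A piece carried ALONG the collision normal hops entirely: `P^{⊗r} n^{⊗r} = n^{⊗r}`. [folklore] -/
theorem mapT_projM_tpow_self {n : V3} (hn : n ≠ 0) : mapT (projM n) (tpow r n) = tpow r n := by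
  rw [mapT_projM_tpow, projV_self hn]

/-- … and leaves nothing on its carrier: `Q^{⊗r} n^{⊗r} = 0` (`r ≥ 1`). [folklore] -/
theorem mapT_coprojM_tpow_self (hr : 0 < r) {n : V3} (hn : n ≠ 0) :
    mapT (coprojM n) (tpow r n) = 0 := by
  rw [mapT_coprojM_tpow, coprojV_self hn, tpow_zero_vec hr]

/-- One step of the incoherent transport on an `ℕ`-indexed family of carriers: the `some (i, j)` branch
of the line's `tStep`, verbatim (`Tᵢ ↦ Q^{⊗r}Tᵢ + P^{⊗r}Tⱼ`, `Tⱼ ↦ Q^{⊗r}Tⱼ + P^{⊗r}Tᵢ`). -/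
def pinch (n : V3) (i j : ℕ) (T : ℕ → Tens r) : ℕ → Tens r :=
  Function.update (Function.update T i (mapT (coprojM n) (T i) + mapT (projM n) (T j))) j
    (mapT (coprojM n) (T j) + mapT (projM n) (T i))

/-- The CRADLE: the chain of steps `(0,1), (1,2), …, (m-1,m)`, all with the same normal `n` (Newton's
cradle: `m + 1` spheres in a row along `n`, struck along `n`). -/
def cradle (n : V3) (m : ℕ) (T : ℕ → Tens r) : ℕ → Tens r :=
  (List.range m).foldl (fun T' k => pinch n k (k + 1) T') T

/-- Unfolding the cradle by one step. [folklore] -/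
theorem cradle_succ (n : V3) (m : ℕ) (T : ℕ → Tens r) :
    cradle n (m + 1) T = pinch n m (m + 1) (cradle n m T) := by
  simp [cradle, List.range_succ, List.foldl_append]

/-- One cradle step moves a piece `n^{⊗r}` sitting alone on carrier `m` entirely onto carrier `m + 1`. [folklore] -/
theorem pinch_single (hr : 0 < r) {n : V3} (hn : n ≠ 0) (m : ℕ) :
    pinch n m (m + 1) (Pi.single m (tpow r n)) = Pi.single (m + 1) (tpow r n) := by
  funext l
  have hm : (Pi.single m (tpow r n) : ℕ → Tens r) m = tpow r n := by simp
  have hm1 : (Pi.single m (tpow r n) : ℕ → Tens r) (m + 1) = 0 := by simp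
  simp only [pinch, hm, hm1, mapT_zero, mapT_projM_tpow_self hn, mapT_coprojM_tpow_self hr hn,
    add_zero, zero_add]
  rcases eq_or_ne l (m + 1) with h1 | h1
  · subst h1; simp
  · rw [Function.update_of_ne h1]
    rcases eq_or_ne l m with h2 | h2
    · subst h2; simp
    · rw [Function.update_of_ne h2]; simp [h1, h2]

/-- **Cradle relay.** Along a chain of `m` collisions with normals parallel to the carried direction, the
incoherent transport moves the injected piece `n^{⊗r}` from carrier `0` to carrier `m` INTACT (every rank
`r ≥ 1`; rank 2 is the impulse-cloud stress of `cd2`/PAST, rank 3 the cubic cloud of `cd3x`).  In the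
hard-sphere realisation (Newton's cradle: `m + 1` spheres at mutual distance `ε_N` along `n`) the cloud mass is
displaced by `m · ε_N` in arbitrarily short time while NO particle moves more than the gaps: incoherent cloud
mass travels through collision chains at the chain's "sound speed", not with the particles.  Hence the
localisation of clouds is NOT the free statement "a particle moves at most `|v| Δ_N` in a window" (Disproof
cycle 1, (I3), true for particles): for `stub_pastDamping`'s weight-gradient term
`Σ_k Σ_i (w_i − w(x_k)) ⟨C, 𝒯(δ_k y_k^{⊗r})_i⟩` one needs the MASS-WEIGHTED cloud displacement to be
`o(N^{-4γ})` in `L¹` along the evolved law, i.e. a bound on chain transport (hops × `ε_N`, or the diameter of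
near-contact clusters met in the window), which neither `CDAlongAt` (a mean depolarisation, blind to where the
pieces sit) nor `TailsOn` (one-particle velocity tails, blind to positions and collision counts) provides; and it
is not reachable by entropy transfer either (a chain of `N^{1/3-4γ}/σ` near-contacts has Gibbs cost
`e^{-O(N^{1/3-4γ})}`, sub-exponential in `N`).  See the module docstring and `Cruxes/AdaptedWeightCLT/Disproof.lean` (F2). [folklore] -/
theorem cradle_relay (hr : 0 < r) {n : V3} (hn : n ≠ 0) (m : ℕ) :
    cradle n m (Pi.single 0 (tpow r n)) = Pi.single m (tpow r n) := by
  induction m with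
  | zero => simp [cradle]
  | succ m ih => rw [cradle_succ, ih, pinch_single hr hn]

/-- The relayed mass is the whole injected mass: the rank-2 piece keeps its full trace `‖n‖²` at distance `m`
hops (trace of `n ⊗ n`). [folklore] -/
theorem cradle_relay_trace {n : V3} (hn : n ≠ 0) (m : ℕ) :
    ∑ c : Fin 3, cradle n m (Pi.single 0 (tpow 2 n)) m (fun _ => c) = ‖n‖ ^ 2 := by
  rw [cradle_relay two_pos hn, Pi.single_eq_same, EuclideanSpace.real_norm_sq_eq]
  refine Finset.sum_congr rfl fun c _ => ?_
  simp [tpow, sq]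

/-- … and nothing is left anywhere else on the chain. [folklore] -/
theorem cradle_relay_of_ne (hr : 0 < r) {n : V3} (hn : n ≠ 0) {m l : ℕ} (h : l ≠ m) :
    cradle n m (Pi.single 0 (tpow r n)) l = 0 := by
  rw [cradle_relay hr hn, Pi.single_eq_of_ne h]

/-- The COHERENT counterpart (velocity transfer along the same cradle, `Wᵢ ↦ QWᵢ + PWⱼ`, `Wⱼ ↦ QWⱼ + PWᵢ`):
a velocity `c • n` on sphere `0` is handed down the row intact as well — the cradle is a pure relay for BOTH
transports, so a perfect cradle keeps a unit block in the rows of `M` (`ipr ≥ 1`) and is itself an H1-violating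
pattern; but H1 prices only the PERFECTION of the relay (normals exactly along the chain), not the DISTANCE
covered: normals at angle `ψ` to the chain pass the fraction `cos²ψ` per hop at rank 2 and still displace it by
`ε_N` per hop. -/
def vpinch (n : V3) (i j : ℕ) (W : ℕ → V3) : ℕ → V3 :=
  Function.update (Function.update W i (coprojV n (W i) + projV n (W j))) j
    (coprojV n (W j) + projV n (W i))

/-- The velocity cradle. -/
def vcradle (n : V3) (m : ℕ) (W : ℕ → V3) : ℕ → V3 :=
  (List.range m).foldl (fun W' k => vpinch n k (k + 1) W') W

/-- `P (c n) = c n`. [folklore] -/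
theorem projV_smul_self {n : V3} (hn : n ≠ 0) (c : ℝ) : projV n (c • n) = c • n := by
  have h : ‖n‖ ^ 2 ≠ 0 := pow_ne_zero 2 (norm_ne_zero_iff.2 hn)
  simp [projV, inner_smul_right, h]

/-- `P 0 = 0`. [folklore] -/
theorem projV_zero_vec (n : V3) : projV n 0 = 0 := by simp [projV]

/-- `Q 0 = 0`. [folklore] -/
theorem coprojV_zero_vec (n : V3) : coprojV n 0 = 0 := by simp [coprojV, projV_zero_vec]

/-- **Velocity cradle relay**: the coherent transfer hands `c • n` down the chain intact. [folklore] -/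
theorem vcradle_relay {n : V3} (hn : n ≠ 0) (c : ℝ) (m : ℕ) :
    vcradle n m (Pi.single 0 (c • n)) = Pi.single m (c • n) := by
  induction m with
  | zero => simp [vcradle]
  | succ m ih =>
    have hstep : vcradle n (m + 1) (Pi.single 0 (c • n)) = vpinch n m (m + 1) (vcradle n m (Pi.single 0 (c • n))) := by
      simp [vcradle, List.range_succ, List.foldl_append]
    rw [hstep, ih]
    funext l
    have hm : (Pi.single m (c • n) : ℕ → V3) m = c • n := by simp
    have hm1 : (Pi.single m (c • n) : ℕ → V3) (m + 1) = 0 := by simp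
    have hQ : coprojV n (c • n) = 0 := by simp [coprojV, projV_smul_self hn]
    simp only [vpinch, hm, hm1, hQ, projV_smul_self hn, projV_zero_vec, coprojV_zero_vec, add_zero, zero_add]
    rcases eq_or_ne l (m + 1) with h1 | h1
    · subst h1; simp
    · rw [Function.update_of_ne h1]
      rcases eq_or_ne l m with h2 | h2
      · subst h2; simp
      · rw [Function.update_of_ne h2]; simp [h1, h2]


end AdaptedWeightCLTNegative

end Summit.AtomisticToContinuum.HydrodynamicLimit.Theorems

end
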